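import Summits.Ventures.PercRepro.ProfileGapMonoThresholdBase
import Summits.Ventures.PercRepro.ProfileGapMonoThresholdGeneric
import Summits.Ventures.PercRepro.ProfileGapMonoThresholdLoop
import Summits.Ventures.PercRepro.ProfileGapMonoThresholdColoop
import Summits.Ventures.PercRepro.ProfileGapMonoThresholdParallel
import Summits.Ventures.PercRepro.ProfileGapMonoThresholdOne

/-!
# PercRepro — THE THRESHOLD FAMILY REDUCES TO THE HARD CLASS (p5, gen 23; `proofs/P5-GM1.md` §21(n); announced
INBOX 11640)

`HardT N q`: `N` has no loop, no parallel pair, no coloop and no `q`-generic point — the cell's hard class at co-rank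
`q`.  `HardRuleT α q t`: every such matroid has a deletion-monotone point for `(q, t)` (a CONJECTURE, NOT asserted).
THE ASSEMBLY: for every `2 ≤ q ≤ t`, `(I_t)` holds on every finite matroid, given the rows `(q' − 1, q')` of every
matroid (`2 ≤ q' ≤ q`; the offset `−1` input of the coloop case at offset `0`) and the rule on the hard class at every
`(q', t')` with `2 ≤ q' ≤ q`, `q' ≤ t'` — by induction on `q` (base `thresholdIneq_one`) and, inside, on `#E`, with the
four point types of the threshold family as kernel lemmas (loop / parallel / `q`-generic / coloop).

* `HardT` (def), `HardRuleT` (conjecture def), `thresholdIneq_of_hardRuleT_aux`, **`thresholdIneq_of_hardRuleT`**,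
  **`starQ_succ_of_hardRuleT`**, `thresholdIneq_of_hardRuleT_le`, `thresholdIneq_row_of_le_three`,
  `thresholdIneq_le_three_of_hardRuleT`, **`starQ_three_four_of_hardRuleT`** (the first hard instance `(★_3)` at
  `u = 4` from the rule at co-ranks `2`, `3` alone — the rows there are tree theorems).
-/

open scoped Matroid

namespace PercRepro.Cogirth

open Finset ThmH Skew Shadow Profile

variable {α : Type} [DecidableEq α] {M : Matroid α} [M.Finite]

section Hard

/-- **The hard class at co-rank `q`**: no loop, no parallel pair, no coloop, no `q`-generic point. -/
def HardT (N : Matroid α) [N.Finite] (q : ℕ) : Prop :=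
  (∀ x ∈ gr N, rk N {x} = 1) ∧
  (∀ x ∈ gr N, ∀ y ∈ gr N, x ≠ y → rk N {x, y} ≠ 1) ∧
  (∀ x ∈ gr N, rk N ((gr N).erase x) + 1 ≠ rk N (gr N)) ∧
  (∀ x ∈ gr N, ¬ GenericQ N x q)

/-- **The rule on the hard class** (a CONJECTURE, NOT asserted): every hard matroid on a nonempty ground set has a
deletion-monotone point for `(q, t)`. -/
def HardRuleT (α : Type) [DecidableEq α] (q t : ℕ) : Prop :=
  ∀ (N : Matroid α) [N.Finite], HardT N q → (gr N).Nonempty → ∃ z ∈ gr N, DelMonoT N z q t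

/-- The inner induction on `#E` at a fixed co-rank `q ≥ 2`, for every `t ≥ q` at once, given the family one co-rank
down (every `t' ≥ q − 1`), the rows `(q − 1, q)` of every matroid, and the rule on the hard class. -/
theorem thresholdIneq_of_hardRuleT_aux {q : ℕ} (hq : 2 ≤ q)
    (hprev : ∀ (K : Matroid α) [K.Finite] (t' : ℕ), q - 1 ≤ t' → ThresholdIneq K (q - 1) t')
    (hrow : ∀ (K : Matroid α) [K.Finite], ThresholdIneq K q (q - 1))
    (hrule : ∀ t', q ≤ t' → HardRuleT α q t') (n : ℕ) :
    ∀ (N : Matroid α) [N.Finite], (gr N).card = n → ∀ t, q ≤ t → ThresholdIneq N q t := by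
  induction n using Nat.strong_induction_on with
  | _ n ih =>
  intro N _ hN t hqt
  -- the induction hypothesis on the deletions, for every threshold `≥ q − 1`
  have ihdel : ∀ z ∈ gr N, ∀ t', q ≤ t' → ThresholdIneq (N ＼ ({z} : Set α)) q t' := by
    intro z hz t' ht'
    have hlt : ((gr N).erase z).card < n := by rw [← hN]; exact card_erase_lt_of_mem hz
    exact ih _ hlt (N ＼ ({z} : Set α)) (by rw [gr_delete']) t' ht'
  have ihdel' : ∀ z ∈ gr N, ∀ t', q - 1 ≤ t' → ThresholdIneq (N ＼ ({z} : Set α)) q t' := by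
    intro z hz t' ht'
    rcases Nat.lt_or_ge t' q with h | h
    · have : t' = q - 1 := by omega
      rw [this]; exact hrow _
    · exact ihdel z hz t' h
  rcases (gr N).eq_empty_or_nonempty with hempty | hne
  · exact thresholdIneq_of_card_eq_zero (by rw [hempty, card_empty])
  -- a loop
  by_cases hloop : ∃ ℓ ∈ gr N, rk N {ℓ} = 0
  · obtain ⟨ℓ, hℓ, h0⟩ := hloop
    exact thresholdIneq_of_loop hℓ h0 (ihdel ℓ hℓ t hqt)
  -- a parallel pair
  by_cases hpar : ∃ z ∈ gr N, ∃ z' ∈ gr N, z ≠ z' ∧ rk N {z, z'} = 1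
  · obtain ⟨z, hz, z', hz', hzz', hpar⟩ := hpar
    have hz1 : rk N {z} = 1 := by
      have h1 := rk_mono' (M := N) (show ({z} : Finset α) ⊆ {z, z'} by simp)
      have h2 : rk N {z} ≠ 0 := fun h => hloop ⟨z, hz, h⟩
      omega
    have hz'1 : rk N {z'} = 1 := by
      have h1 := rk_mono' (M := N) (show ({z'} : Finset α) ⊆ {z, z'} by simp)
      have h2 : rk N {z'} ≠ 0 := fun h => hloop ⟨z', hz', h⟩
      omega
    have hdm := delMonoT_of_parallel hz hz' hzz' hz1 hz'1 hpar hq (by omega)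
      (hprev _ (t - 1) (by omega))
    exact thresholdIneq_of_delMonoT hdm (ihdel z hz t hqt)
  -- a coloop
  by_cases hcol : ∃ z ∈ gr N, rk N ((gr N).erase z) + 1 = rk N (gr N)
  · obtain ⟨z, hz, hzc⟩ := hcol
    exact thresholdIneq_of_coloop hz hzc hq (by omega) (ihdel' z hz (t - 1) (by omega))
      (hprev _ t (by omega))
  -- a generic point
  by_cases hgen : ∃ z ∈ gr N, GenericQ N z q
  · obtain ⟨z, hz, hg⟩ := hgen
    have hz1 : rk N {z} = 1 := by
      have h2 : rk N {z} ≠ 0 := fun h => hloop ⟨z, hz, h⟩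
      have h3 : rk N {z} ≤ 1 := by
        have := rk_le_card (M := N) ({z} : Finset α)
        simpa using this
      omega
    have hzI : N.Indep {z} := by
      have h := indep_of_rk_eq_card (M := N) (X := {z}) (by rw [card_singleton]; exact hz1)
      rwa [coe_singleton] at h
    have hdm := delMonoT_of_genericQ hzI hg hq (by omega) (hprev _ (t - 1) (by omega))
    exact thresholdIneq_of_delMonoT hdm (ihdel z hz t hqt)
  -- the hard class: the rule
  have hhard : HardT N q := by
    refine ⟨?_, ?_, ?_, ?_⟩
    · intro x hx
      have h2 : rk N {x} ≠ 0 := fun h => hloop ⟨x, hx, h⟩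
      have h3 : rk N {x} ≤ 1 := by
        have := rk_le_card (M := N) ({x} : Finset α)
        simpa using this
      omega
    · intro x hx y hy hxy h
      exact hpar ⟨x, hx, y, hy, hxy, h⟩
    · intro x hx h
      exact hcol ⟨x, hx, h⟩
    · intro x hx h
      exact hgen ⟨x, hx, h⟩
  obtain ⟨z, hz, hdm⟩ := hrule t hqt N hhard hne
  exact thresholdIneq_of_delMonoT hdm (ihdel z hz t hqt)

/-- **The threshold family at every offset `≥ 0` from the rows and the rule on the hard class**: for `2 ≤ q ≤ t`,
`(I_t)` on every finite matroid, given the rows `(q' − 1, q')` of every matroid and `HardRuleT α q' t'` for all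
`2 ≤ q' ≤ q`, `q' ≤ t'`. -/
theorem thresholdIneq_of_hardRuleT
    (hrow : ∀ (K : Matroid α) [K.Finite] (q' : ℕ), 2 ≤ q' → ThresholdIneq K q' (q' - 1))
    (hrule : ∀ q' t', 2 ≤ q' → q' ≤ t' → HardRuleT α q' t') :
    ∀ q, 2 ≤ q → ∀ (N : Matroid α) [N.Finite], ∀ t, q ≤ t → ThresholdIneq N q t := by
  intro q
  induction q with
  | zero => intro h; omega
  | succ q ihq =>
    intro hq N _ t hqt
    have hprev : ∀ (K : Matroid α) [K.Finite] (t' : ℕ), q + 1 - 1 ≤ t' → ThresholdIneq K (q + 1 - 1) t' := by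
      intro K _ t' ht'
      rw [Nat.add_sub_cancel] at ht' ⊢
      rcases Nat.lt_or_ge q 2 with h | h
      · have : q = 1 := by omega
        rw [this]; exact thresholdIneq_one K t'
      · exact ihq h K t' ht'
    exact thresholdIneq_of_hardRuleT_aux hq hprev (fun K _ => hrow K (q + 1) hq)
      (fun t' ht' => hrule (q + 1) t' hq ht') _ N rfl t hqt

/-- **`(★_q)` at the level `u = q + 1`, hence `(GM)_q` at every coloop at that level, from the rows and the rule on
the hard class** (`2 ≤ q`). -/
theorem starQ_succ_of_hardRuleT {z : α} {q : ℕ} (hq : 2 ≤ q)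
    (hrow : ∀ (K : Matroid α) [K.Finite] (q' : ℕ), 2 ≤ q' → ThresholdIneq K q' (q' - 1))
    (hrule : ∀ q' t', 2 ≤ q' → q' ≤ t' → HardRuleT α q' t') : StarQ M z q (q + 1) :=
  (starQ_succ_iff_thresholdIneq (by omega)).2
    (thresholdIneq_of_hardRuleT hrow hrule q hq _ (q + 1) (by omega))

/-- **The same, with the rows and the rule only up to a co-rank bound `Q`.** -/
theorem thresholdIneq_of_hardRuleT_le (Q : ℕ)
    (hrow : ∀ (K : Matroid α) [K.Finite] (q' : ℕ), 2 ≤ q' → q' ≤ Q → ThresholdIneq K q' (q' - 1))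
    (hrule : ∀ q' t', 2 ≤ q' → q' ≤ Q → q' ≤ t' → HardRuleT α q' t') :
    ∀ q, 2 ≤ q → q ≤ Q → ∀ (N : Matroid α) [N.Finite], ∀ t, q ≤ t → ThresholdIneq N q t := by
  intro q
  induction q with
  | zero => intro h; omega
  | succ q ihq =>
    intro hq hqQ N _ t hqt
    have hprev : ∀ (K : Matroid α) [K.Finite] (t' : ℕ), q + 1 - 1 ≤ t' → ThresholdIneq K (q + 1 - 1) t' := by
      intro K _ t' ht'
      rw [Nat.add_sub_cancel] at ht' ⊢
      rcases Nat.lt_or_ge q 2 with h | h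
      · have : q = 1 := by omega
        rw [this]; exact thresholdIneq_one K t'
      · exact ihq h (by omega) K t' ht'
    exact thresholdIneq_of_hardRuleT_aux hq hprev (fun K _ => hrow K (q + 1) hq hqQ)
      (fun t' ht' => hrule (q + 1) t' hq hqQ ht') _ N rfl t hqt

/-- The rows `(1, 2)` and `(2, 3)` are tree theorems (`profileIneqMinusQ_one_all`, `profileIneqMinusQ_two_all`):
the row hypothesis of the assembly holds for `q' ≤ 3`. -/
theorem thresholdIneq_row_of_le_three (K : Matroid α) [K.Finite] {q' : ℕ} (hq' : 2 ≤ q') (hq'3 : q' ≤ 3) :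
    ThresholdIneq K q' (q' - 1) := by
  rw [thresholdIneq_iff_row (by omega)]
  rcases (show q' = 2 ∨ q' = 3 by omega) with rfl | rfl
  · exact profileIneqMinusQ_one_all K (by norm_num)
  · exact profileIneqMinusQ_two_all K 3 (by norm_num)

/-- **`(I_t)` at co-ranks `2` and `3` from the rule on the hard class alone** (the rows there are tree theorems). -/
theorem thresholdIneq_le_three_of_hardRuleT
    (hrule : ∀ q' t', 2 ≤ q' → q' ≤ 3 → q' ≤ t' → HardRuleT α q' t') {q : ℕ} (hq : 2 ≤ q) (hq3 : q ≤ 3)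
    (N : Matroid α) [N.Finite] {t : ℕ} (hqt : q ≤ t) : ThresholdIneq N q t :=
  thresholdIneq_of_hardRuleT_le 3 (fun K _ _ h1 h2 => thresholdIneq_row_of_le_three K h1 h2) hrule q hq hq3 N t hqt

/-- **The first hard instance of the coloop band case, `(★_3)` at `u = 4`, from the rule on the hard class at
co-ranks `2` and `3` alone.** -/
theorem starQ_three_four_of_hardRuleT {z : α}
    (hrule : ∀ q' t', 2 ≤ q' → q' ≤ 3 → q' ≤ t' → HardRuleT α q' t') : StarQ M z 3 4 :=
  (starQ_succ_iff_thresholdIneq (by norm_num)).2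
    (thresholdIneq_le_three_of_hardRuleT hrule (by norm_num) (by norm_num) _ (by norm_num))

end Hard

end PercRepro.Cogirth
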